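import Literature.NumberTheory.EllipticCurves.JZeroFixedPointsAdmissible
import HarnessLib

/-!
# The `p = 2` CM-frame Kolyvagin classes, assembled: `E(H) = E(k̄)^{Gal(k̄/H)}` as Mathlib's
# `FixedPoints.addSubgroup`, and the transported `χ`-components `ψ(P_n^χ) ∈ E^χ(k̄)` as inputs of
# the tree's `kolyvaginClass` (Gross 1991 §4 / §12 in Hu–Shu–Yin's cube-sum frame)

This file specialises the three bricks `CubicTwistTransportJZero` (the transport
`ψ : E(k̄) ≃+ E'(k̄)`, `E' = E^χ` a cubic twist, with its law `g ψ = ψ ρ_g g`),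
`KolyvaginChiComponent` (the `χ`-component `P^χ = Σ_i ρ_{t_i}(t_i P)` is `(Γ, χ)`-isotypic) and
`JZeroFixedPointsAdmissible` (no `2`-power torsion over `H`) to the subgroup
`A = E(k̄)^N := FixedPoints.addSubgroup N E(k̄)` of a subgroup `N ≤ Γ_k` (printed: `N = Gal(k̄/H)`,
`A = E(H)`, `H = H_{9pn}` the ring class field of conductor `9pn` of `K = ℚ(√−3)` in Hu–Shu–Yin's
frame; Gross 1991 §4: `E(K_n)`), so that every side condition of the tree's McCallum-cocycle class
`kolyvaginClass W' m hdiv hA P hP ∈ H¹(k, E'[m])` (`HeegnerPointsKolyvaginPrimaryClassesProofs`) is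
discharged from: `N` normal in `Γ_k`, `μ₃ ⊂ k`, `N` fixes `v = ∛c`, and the single arithmetic
input *"`x³ + b` has no root in `H`"* (`E : y² = x³ + b`). What remains for a user (rows k-p1/k-p2 of
crux `UpperOffV0HSYPlus`, memo "two" §57.3–§57.4) are the genuinely arithmetic inputs: the points
`y_n ∈ E_9(H_{9pn})` and the invariance of the class of the derived point `P_n` modulo `2^M E_9(H_{9pn})`
under `Gal(k̄/L)` (Gross Prop. 3.6 from the Euler-system relation (ES1); the group-ring algebra is the
tree's `exists_sub_one_smul_kolyvaginDerivative_smul_eq`).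

* `JZero.mem_fixedPoints_iff` — `P ∈ E(k̄)^N ↔ ∀ h ∈ N, hP = P`;
  `JZero.smul_mem_fixedPoints` (`Γ_k`-stable for `N` normal), `JZero.rho_mem_fixedPoints`
  (`ρ_g`-stable when `μ₃ ⊂ k`);
* `JZero.isAdmissible_fixedPoints_two_pow`, `JZero.isAdmissible_map_fixedPoints_two_pow` — Gross's
  Lemma 4.3 at `2^M` for `E(k̄)^N` and for `ψ(E(k̄)^N)` from the no-root hypothesis;
* `JZero.cubicTwist_chiComponent_fixedPoints_mem_invPoints` — `ψ(P^χ) ∈ invPoints Γ_k ψ(E(k̄)^N) m`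
  from the `N'`-invariance of `[P]` (`N' ≤ Γ_k` fixing `v`, `t` representatives of `Γ_k/N'`);
* `JZero.kolyvaginClass_cubicTwist_fixedPoints_eq_zero_iff` (Gross Prop. 4.7 (1):
  `c(ψQ) = 0 ↔ Q ∈ m E(k̄)^N`), `JZero.torsionH1ToH1_kolyvaginClass_cubicTwist_fixedPoints_eq_zero_iff`
  (Prop. 4.7 (2): `d(ψQ) = 0 ↔ Q ∈ m E(k̄)^N + E^χ(k)`);
* `HuShuYin2019.exists_cmFrame_transport` — for `K ⊇ ℚ(ω)` and `b = a c`, `c ≠ 0`: a cube root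
  `v ∈ K̄` of `c`, the transport `ψ : E_a(K̄) ≃+ E_b(K̄)` and the family `ρ` with ALL their algebra
  (coordinates, twist law, `ρ_{gg'} = ρ_g ρ_{g'}`, `Γ_K`-equivariance of `ρ_g`, `ρ_g = 1` when
  `g v = v`) in one statement ((a, b, c) = (9, p, p/9): `E_9 ≅ E_p`; (9, 3p², p²/3): `E_9 ≅ E_{3p²}`);
  `HuShuYin2019.isAdmissible_map_fixedPoints_cubeSumCurve_nine` — `ψ(E_9(K̄)^N)` is admissible at
  every `2^M` once no `N`-fixed `z` has `z³ = 6`.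

Everything is proved; no definition (the subgroup is Mathlib's `FixedPoints.addSubgroup`), no named
fact, no `sorry`; no Selmer-group statement; BSD is not claimed.

## References

* [GrossLMS1991] B. H. Gross, *Kolyvagin's work on modular elliptic curves*, LMS LN 153 (1991):
  §4 (`E(K_n)`, (4.1)–(4.4), Lemma 4.3, Prop. 4.7), §12 (`y_χ`). Held PDF pp. 217–219, 232.
* [McCallumLMS1991] W. G. McCallum, same volume, §4 (4)–(6), Cor. 4.5.
* [HuShuYin2019] Y. Hu, J. Shu, H. Yin, Trans. AMS 372 (2019), §1 p. 4, §2 p. 8.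
* [SilvermanAEC2009] J. H. Silverman, *AEC*, GTM 106, VIII.§1 (`E(K̄)^{G_{K̄/L}} = E(L)`), X.2, X.5.4.
-/

noncomputable section

open scoped Classical
open WeierstrassCurve

universe u w

namespace Literature.NumberTheory.EllipticCurves

namespace JZero

/-! ## §1 `E(H) = E(k̄)^N` as `FixedPoints.addSubgroup` -/

section FixedPoints

variable {k : Type u} [Field k] (W : WeierstrassCurve k)

/-- **`E(k̄)^N`**: membership in Mathlib's `FixedPoints.addSubgroup N E(k̄)` for a subgroup
`N ≤ Γ_k` is `hP = P` for all `h ∈ N` (printed: `N = Gal(k̄/H)`, the subgroup is `E(H)`;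
Gross 1991 §4: `E(K_n) ⊂ E(K̄)`). [cite: SilvermanAEC2009, VIII.§1] [cite: GrossLMS1991, §4 (4.2)] -/
theorem mem_fixedPoints_iff (N : Subgroup (Field.absoluteGaloisGroup k)) (P : geomPoints W) :
    P ∈ FixedPoints.addSubgroup N (geomPoints W) ↔ ∀ h ∈ N, h • P = P := by
  rw [FixedPoints.mem_addSubgroup]
  exact ⟨fun H h hh ↦ H ⟨h, hh⟩, fun H m ↦ H m m.2⟩

/-- A normal subgroup is normalised: `g⁻¹ h g ∈ N`. [folklore] -/
private theorem inv_mul_mul_mem (N : Subgroup (Field.absoluteGaloisGroup k)) [hN : N.Normal]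
    (g : Field.absoluteGaloisGroup k) (h : Field.absoluteGaloisGroup k) (hh : h ∈ N) :
    g⁻¹ * h * g ∈ N := by
  simpa using hN.conj_mem h hh g⁻¹

/-- `E(k̄)^N` is `Γ_k`-stable when `N` is normal (printed: `K_n/K` is Galois).
[cite: GrossLMS1991, §4 (4.2)] -/
theorem smul_mem_fixedPoints (N : Subgroup (Field.absoluteGaloisGroup k)) [N.Normal]
    (g : Field.absoluteGaloisGroup k) {P : geomPoints W}
    (hP : P ∈ FixedPoints.addSubgroup N (geomPoints W)) :
    g • P ∈ FixedPoints.addSubgroup N (geomPoints W) := by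
  rw [mem_fixedPoints_iff] at hP ⊢
  intro h hh
  have e : h • g • P = g • (g⁻¹ * h * g) • P := by
    rw [← mul_smul, ← mul_smul]; congr 1; group
  rw [e, hP _ (inv_mul_mul_mem N g h hh)]

/-- `E(k̄)^N` is stable under the CM automorphisms `ρ_g` when `μ₃ ⊂ k`.
[cite: HuShuYin2019, §1 p. 4 ([ω] defined over K)] -/
theorem rho_mem_fixedPoints {ω : k} (hω : ω ^ 2 + ω + 1 = 0) {v : AlgebraicClosure k} (hv : v ≠ 0)
    (hv3 : ∀ g : Field.absoluteGaloisGroup k,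
      ((show AlgebraicClosure k ≃ₐ[k] AlgebraicClosure k from g) v) ^ 3 = v ^ 3)
    {ρ : Field.absoluteGaloisGroup k → geomPoints W ≃+ geomPoints W}
    (hρ : ∀ (g : Field.absoluteGaloisGroup k) {x y : AlgebraicClosure k}
        (h : (W.baseChange (AlgebraicClosure k)).toAffine.Nonsingular x y),
        ∃ h', ρ g (Affine.Point.some x y h) =
          Affine.Point.some (((show AlgebraicClosure k ≃ₐ[k] AlgebraicClosure k from g) v / v) ^ 2 * x)
            y h')
    (N : Subgroup (Field.absoluteGaloisGroup k)) (g : Field.absoluteGaloisGroup k) {P : geomPoints W}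
    (hP : P ∈ FixedPoints.addSubgroup N (geomPoints W)) :
    ρ g P ∈ FixedPoints.addSubgroup N (geomPoints W) := by
  rw [mem_fixedPoints_iff] at hP ⊢
  exact smul_rho_eq_self_of_forall hω hv hv3 hρ hP g

/-- **Gross's Lemma 4.3 at level `2^M` for `E(k̄)^N`** (`a₁ = a₃ = 0`, char. `0`, `N` normal, no
`N`-fixed root of `x³ + a₂x² + a₄x + a₆`). [cite: GrossLMS1991, Lemma 4.3] [cite: McCallumLMS1991, §4 (5)] -/
theorem isAdmissible_fixedPoints_two_pow [CharZero k] (ha₁ : W.a₁ = 0) (ha₃ : W.a₃ = 0)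
    (N : Subgroup (Field.absoluteGaloisGroup k)) [N.Normal]
    (hroot : ∀ x : AlgebraicClosure k,
      (∀ h ∈ N, (show AlgebraicClosure k ≃ₐ[k] AlgebraicClosure k from h) x = x) →
        x ^ 3 + algebraMap k _ W.a₂ * x ^ 2 + algebraMap k _ W.a₄ * x + algebraMap k _ W.a₆ ≠ 0)
    (M : ℕ) :
    KolyvaginCocycle.IsAdmissible (Field.absoluteGaloisGroup k)
      (FixedPoints.addSubgroup N (geomPoints W)) ((2 ^ M : ℕ) : ℤ) :=
  isAdmissible_of_forall_smul_eq W ha₁ ha₃ (inv_mul_mul_mem N) hroot (mem_fixedPoints_iff W N) M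

variable {W} {W' : WeierstrassCurve k}

/-- **Gross's Lemma 4.3 at level `2^M` for the transported subgroup `ψ(E(k̄)^N) = E'(k̄)^N`**
(`E : y² = x³ + b` with no `N`-fixed root of `x³ + b`; `μ₃ ⊂ k`; `ψ` the cubic-twist transport).
[cite: GrossLMS1991, Lemma 4.3] [cite: McCallumLMS1991, §4 (5)] -/
theorem isAdmissible_map_fixedPoints_two_pow [CharZero k] (ha₁ : W.a₁ = 0) (ha₂ : W.a₂ = 0)
    (ha₃ : W.a₃ = 0) (ha₄ : W.a₄ = 0) {ω : k} (hω : ω ^ 2 + ω + 1 = 0)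
    {v : AlgebraicClosure k} (hv : v ≠ 0)
    (hv3 : ∀ g : Field.absoluteGaloisGroup k,
      ((show AlgebraicClosure k ≃ₐ[k] AlgebraicClosure k from g) v) ^ 3 = v ^ 3)
    {ψ : geomPoints W ≃+ geomPoints W'}
    {ρ : Field.absoluteGaloisGroup k → geomPoints W ≃+ geomPoints W}
    (hρ : ∀ (g : Field.absoluteGaloisGroup k) {x y : AlgebraicClosure k}
        (h : (W.baseChange (AlgebraicClosure k)).toAffine.Nonsingular x y),
        ∃ h', ρ g (Affine.Point.some x y h) =
          Affine.Point.some (((show AlgebraicClosure k ≃ₐ[k] AlgebraicClosure k from g) v / v) ^ 2 * x)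
            y h')
    (hlaw : ∀ (g : Field.absoluteGaloisGroup k) (P : geomPoints W), g • ψ P = ψ (ρ g (g • P)))
    (N : Subgroup (Field.absoluteGaloisGroup k)) [N.Normal]
    (hroot : ∀ x : AlgebraicClosure k,
      (∀ h ∈ N, (show AlgebraicClosure k ≃ₐ[k] AlgebraicClosure k from h) x = x) →
        x ^ 3 + algebraMap k _ W.a₆ ≠ 0)
    (M : ℕ) :
    KolyvaginCocycle.IsAdmissible (Field.absoluteGaloisGroup k)
      ((FixedPoints.addSubgroup N (geomPoints W)).map ψ.toAddMonoidHom) ((2 ^ M : ℕ) : ℤ) :=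
  isAdmissible_map_cubicTwist_of_forall_smul_eq ha₁ ha₂ ha₃ ha₄ hω hv hv3 hρ hlaw (inv_mul_mul_mem N)
    hroot (mem_fixedPoints_iff W N) M

/-- **The input of the twisted class over `E(k̄)^N`**: for `P ∈ E(k̄)^N` (the derived point `P_n`)
whose class mod `m E(k̄)^N` is fixed by a subgroup `N' ≤ Γ_k` fixing `v` (printed `Gal(k̄/L)`), with
representatives `t` of `Γ_k/N'`, the transported `χ`-component `ψ(Σ_i ρ_{t_i}(t_i P))` lies in
`invPoints Γ_k ψ(E(k̄)^N) m` (`N` normal, `μ₃ ⊂ k`). [cite: GrossLMS1991, §12 (y_χ), §4 (4.1)–(4.4)]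
[cite: McCallumLMS1991, §4 (4)] -/
theorem cubicTwist_chiComponent_fixedPoints_mem_invPoints {ω : k} (hω : ω ^ 2 + ω + 1 = 0)
    {v : AlgebraicClosure k} (hv : v ≠ 0)
    (hv3 : ∀ g : Field.absoluteGaloisGroup k,
      ((show AlgebraicClosure k ≃ₐ[k] AlgebraicClosure k from g) v) ^ 3 = v ^ 3)
    {ψ : geomPoints W ≃+ geomPoints W'}
    {ρ : Field.absoluteGaloisGroup k → geomPoints W ≃+ geomPoints W}
    (hρ : ∀ (g : Field.absoluteGaloisGroup k) {x y : AlgebraicClosure k}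
        (h : (W.baseChange (AlgebraicClosure k)).toAffine.Nonsingular x y),
        ∃ h', ρ g (Affine.Point.some x y h) =
          Affine.Point.some (((show AlgebraicClosure k ≃ₐ[k] AlgebraicClosure k from g) v / v) ^ 2 * x)
            y h')
    (hlaw : ∀ (g : Field.absoluteGaloisGroup k) (P : geomPoints W), g • ψ P = ψ (ρ g (g • P)))
    (N : Subgroup (Field.absoluteGaloisGroup k)) [N.Normal]
    {N' : Subgroup (Field.absoluteGaloisGroup k)}
    (hN' : ∀ h ∈ N', (show AlgebraicClosure k ≃ₐ[k] AlgebraicClosure k from h) v = v)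
    {ι : Type w} [Fintype ι] (t : ι → Field.absoluteGaloisGroup k)
    (ht : Function.Bijective fun i ↦ (t i : Field.absoluteGaloisGroup k ⧸ N'))
    {m : ℤ} {P : geomPoints W} (hPN : P ∈ FixedPoints.addSubgroup N (geomPoints W))
    (hP : ∀ h ∈ N', ∃ a ∈ FixedPoints.addSubgroup N (geomPoints W), m • a = h • P - P) :
    ψ (∑ i, ρ (t i) (t i • P)) ∈
      KolyvaginCocycle.invPoints (Field.absoluteGaloisGroup k)
        ((FixedPoints.addSubgroup N (geomPoints W)).map ψ.toAddMonoidHom) m :=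
  cubicTwist_chiComponent_mem_invPoints hω hv hv3 hρ hlaw
    (fun g _ ha ↦ smul_mem_fixedPoints W N g ha) (fun g _ ha ↦ rho_mem_fixedPoints W hω hv hv3 hρ N g ha)
    hN' t ht hPN hP

/-- **Gross's Prop. 4.7 (1) over `E(k̄)^N`, twisted**: for `N ≤ Γ_k` fixing `v` and `Q ∈ E(k̄)^N`,
`c(ψ Q) = 0 ↔ Q ∈ m E(k̄)^N` (*"`c(n) = 0 ⟺ P_n^χ ∈ 2^M E_9(H_{9pn})`"*).
[cite: GrossLMS1991, Prop. 4.7 (1)] [cite: McCallumLMS1991, Cor. 4.5] -/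
theorem kolyvaginClass_cubicTwist_fixedPoints_eq_zero_iff {v : AlgebraicClosure k}
    {ψ : geomPoints W ≃+ geomPoints W'}
    (hψ : ∀ {x y : AlgebraicClosure k} (h : (W.baseChange (AlgebraicClosure k)).toAffine.Nonsingular x y),
        ∃ h', ψ (Affine.Point.some x y h) = Affine.Point.some (v ^ 2 * x) (v ^ 3 * y) h')
    (N : Subgroup (Field.absoluteGaloisGroup k))
    (hN : ∀ h ∈ N, (show AlgebraicClosure k ≃ₐ[k] AlgebraicClosure k from h) v = v)
    {Q : geomPoints W} (hQ : Q ∈ FixedPoints.addSubgroup N (geomPoints W)) {m : ℤ}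
    {hdiv : ∀ P : geomPoints W', ∃ R : geomPoints W', m • R = P}
    (hA' : KolyvaginCocycle.IsAdmissible (Field.absoluteGaloisGroup k)
      ((FixedPoints.addSubgroup N (geomPoints W)).map ψ.toAddMonoidHom) m)
    (hQ' : ψ Q ∈ KolyvaginCocycle.invPoints (Field.absoluteGaloisGroup k)
      ((FixedPoints.addSubgroup N (geomPoints W)).map ψ.toAddMonoidHom) m) :
    kolyvaginClass W' m hdiv hA' (ψ Q) hQ' = 0 ↔
      ∃ B ∈ FixedPoints.addSubgroup N (geomPoints W), m • B = Q :=
  kolyvaginClass_cubicTwist_eq_zero_iff hψ (N := (N : Set (Field.absoluteGaloisGroup k))) hN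
    (fun P hP ↦ (mem_fixedPoints_iff W N P).mpr hP) ((mem_fixedPoints_iff W N Q).mp hQ) hA' hQ'

/-- **Gross's Prop. 4.7 (2) over `E(k̄)^N`, twisted** (perfect `k`): `d(ψ Q) = 0 ↔ Q ∈ m E(k̄)^N +
E^χ(k)`, `E^χ(k) = {Q₀ : ρ_g (g Q₀) = Q₀ ∀ g}`. [cite: GrossLMS1991, Prop. 4.7 (2)] -/
theorem torsionH1ToH1_kolyvaginClass_cubicTwist_fixedPoints_eq_zero_iff [PerfectField k]
    {v : AlgebraicClosure k} {ψ : geomPoints W ≃+ geomPoints W'}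
    (hψ : ∀ {x y : AlgebraicClosure k} (h : (W.baseChange (AlgebraicClosure k)).toAffine.Nonsingular x y),
        ∃ h', ψ (Affine.Point.some x y h) = Affine.Point.some (v ^ 2 * x) (v ^ 3 * y) h')
    {ρ : Field.absoluteGaloisGroup k → geomPoints W ≃+ geomPoints W}
    (hlaw : ∀ (g : Field.absoluteGaloisGroup k) (P : geomPoints W), g • ψ P = ψ (ρ g (g • P)))
    (N : Subgroup (Field.absoluteGaloisGroup k))
    (hN : ∀ h ∈ N, (show AlgebraicClosure k ≃ₐ[k] AlgebraicClosure k from h) v = v)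
    {Q : geomPoints W} (hQ : Q ∈ FixedPoints.addSubgroup N (geomPoints W)) {m : ℤ}
    {hdiv : ∀ P : geomPoints W', ∃ R : geomPoints W', m • R = P}
    (hA' : KolyvaginCocycle.IsAdmissible (Field.absoluteGaloisGroup k)
      ((FixedPoints.addSubgroup N (geomPoints W)).map ψ.toAddMonoidHom) m)
    (hQ' : ψ Q ∈ KolyvaginCocycle.invPoints (Field.absoluteGaloisGroup k)
      ((FixedPoints.addSubgroup N (geomPoints W)).map ψ.toAddMonoidHom) m) :
    torsionH1ToH1 W' m (kolyvaginClass W' m hdiv hA' (ψ Q) hQ') = 0 ↔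
      ∃ B ∈ FixedPoints.addSubgroup N (geomPoints W), ∃ Q₀ : geomPoints W,
        (∀ g : Field.absoluteGaloisGroup k, ρ g (g • Q₀) = Q₀) ∧ Q = m • B + Q₀ :=
  torsionH1ToH1_kolyvaginClass_cubicTwist_eq_zero_iff hψ hlaw (N := (N : Set (Field.absoluteGaloisGroup k)))
    hN (fun P hP ↦ (mem_fixedPoints_iff W N P).mpr hP) ((mem_fixedPoints_iff W N Q).mp hQ) hA' hQ'

end FixedPoints

end JZero

/-! ## §2 Hu–Shu–Yin's frame: everything about `ψ : E_a(K̄) ≃+ E_{ac}(K̄)` in one statement -/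

namespace HuShuYin2019

/-- **The CM-frame transport for the cube-sum curves, bundled.** For a field `K ⊇ ℚ(ω)`
(`ω² + ω + 1 = 0`; printed `K = ℚ(√−3)`) and `b = a c` with `c ≠ 0` there are: a cube root
`v ∈ K̄` of `c`, the transport `ψ : E_a(K̄) ≃+ E_b(K̄)`, `(x, y) ↦ (v² x, v³ y)` (Hu–Shu–Yin's
`(x, y) ↦ ((∛p)²x, py)` for `(a, b) = (1, p)`), and the family `ρ_g = [χ(g)²]`, `χ(g) = g(v)/v`
(Hu–Shu–Yin's `χ(σ) = (∛(3p))^{σ−1}` for `c = p/9`), with: the twist law `g (ψ P) = ψ (ρ_g (g P))`,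
`ρ_{gg'} = ρ_g ρ_{g'}` (`χ` is a character), `h ρ_g = ρ_g h` (`μ₃ ⊂ K`), `ρ_g = 1` if `g v = v`.
Uses: `(a, b, c) = (9, p, p/9)` (`E_9 ≅ E_p = B`), `(9, 3p², p²/3)` (`E_9 ≅ E_{3p²} = A`).
[cite: HuShuYin2019, §1 p. 4, §2 p. 8] [cite: SilvermanAEC2009, X.2.2, X.5.4] -/
theorem exists_cmFrame_transport (K : Type u) [Field K] [CharZero K] {ω : K} (hω : ω ^ 2 + ω + 1 = 0)
    (a b c : ℚ) (hc : c ≠ 0) (hb : b = a * c) :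
    ∃ (v : AlgebraicClosure K)
      (ψ : geomPoints ((cubeSumCurve a).baseChange K) ≃+ geomPoints ((cubeSumCurve b).baseChange K))
      (ρ : Field.absoluteGaloisGroup K →
        geomPoints ((cubeSumCurve a).baseChange K) ≃+ geomPoints ((cubeSumCurve a).baseChange K)),
      v ^ 3 = algebraMap ℚ (AlgebraicClosure K) c ∧ v ≠ 0 ∧
      (∀ g : Field.absoluteGaloisGroup K,
        ((show AlgebraicClosure K ≃ₐ[K] AlgebraicClosure K from g) v) ^ 3 = v ^ 3) ∧
      (∀ {x y : AlgebraicClosure K}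
        (h : (((cubeSumCurve a).baseChange K).baseChange (AlgebraicClosure K)).toAffine.Nonsingular x y),
        ∃ h', ψ (Affine.Point.some x y h) = Affine.Point.some (v ^ 2 * x) (v ^ 3 * y) h') ∧
      (∀ (g : Field.absoluteGaloisGroup K) {x y : AlgebraicClosure K}
        (h : (((cubeSumCurve a).baseChange K).baseChange (AlgebraicClosure K)).toAffine.Nonsingular x y),
        ∃ h', ρ g (Affine.Point.some x y h) =
          Affine.Point.some (((show AlgebraicClosure K ≃ₐ[K] AlgebraicClosure K from g) v / v) ^ 2 * x)
            y h') ∧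
      (∀ (g : Field.absoluteGaloisGroup K) (P : geomPoints ((cubeSumCurve a).baseChange K)),
        g • ψ P = ψ (ρ g (g • P))) ∧
      (∀ (g g' : Field.absoluteGaloisGroup K) (P : geomPoints ((cubeSumCurve a).baseChange K)),
        ρ (g * g') P = ρ g (ρ g' P)) ∧
      (∀ (g h : Field.absoluteGaloisGroup K) (P : geomPoints ((cubeSumCurve a).baseChange K)),
        h • ρ g P = ρ g (h • P)) ∧
      (∀ g : Field.absoluteGaloisGroup K,
        (show AlgebraicClosure K ≃ₐ[K] AlgebraicClosure K from g) v = v →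
          ∀ P : geomPoints ((cubeSumCurve a).baseChange K), ρ g P = P) := by
  subst hb
  obtain ⟨v, hvc⟩ := IsAlgClosed.exists_pow_nat_eq (algebraMap ℚ (AlgebraicClosure K) c)
    (by norm_num : 0 < 3)
  have hv : v ≠ 0 := by
    rintro rfl
    rw [zero_pow three_ne_zero, eq_comm, map_eq_zero] at hvc
    exact hc hvc
  have hvc' : v ^ 3 = algebraMap K (AlgebraicClosure K) (algebraMap ℚ K c) := by
    rw [hvc, eq_ratCast (algebraMap ℚ K), map_ratCast, eq_ratCast]
  have hv3 : ∀ g : Field.absoluteGaloisGroup K,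
      ((show AlgebraicClosure K ≃ₐ[K] AlgebraicClosure K from g) v) ^ 3 = v ^ 3 :=
    JZero.pow_three_smul_eq hvc'
  obtain ⟨ψ, ρ, hψ, hρ, hlaw⟩ := exists_cubicTwist_transport_cubeSumCurve K a c hc hvc
  exact ⟨v, ψ, ρ, hvc, hv, hv3, hψ, hρ, hlaw,
    fun g g' P ↦ JZero.rho_mul_apply_of_omega hω hv hv3 hρ g g' P,
    fun g h P ↦ JZero.smul_rho_of_omega hω hv hv3 hρ g h P,
    fun g hg P ↦ JZero.rho_apply_of_apply_eq hv hρ hg P⟩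

/-- **`ψ(E_9(K̄)^N)` is admissible at every `2^M`** once no `N`-fixed `z ∈ K̄` satisfies `z³ = 6`
(`E_9 : y² = x³ − 2⁴3⁷`, `x³ = 2⁴3⁷ ⇔ (x/18)³ = 6`; printed: `E_9[2]`, hence `B[2]`, `A[2]`, vanish
over `H_{9pn}` — memo two §57.3), for the transport `ψ` to any cubic twist `E_b`, `N` normal, `μ₃ ⊂ K`.
[cite: GrossLMS1991, Lemma 4.3] [cite: HuShuYin2019, §2.1 p. 5 (E_9 : y² = x³ − 2⁴·3⁷)] -/
theorem isAdmissible_map_fixedPoints_cubeSumCurve_nine (K : Type u) [Field K] [CharZero K]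
    {ω : K} (hω : ω ^ 2 + ω + 1 = 0) {v : AlgebraicClosure K} (hv : v ≠ 0)
    (hv3 : ∀ g : Field.absoluteGaloisGroup K,
      ((show AlgebraicClosure K ≃ₐ[K] AlgebraicClosure K from g) v) ^ 3 = v ^ 3)
    {b : ℚ}
    {ψ : geomPoints ((cubeSumCurve 9).baseChange K) ≃+ geomPoints ((cubeSumCurve b).baseChange K)}
    {ρ : Field.absoluteGaloisGroup K →
      geomPoints ((cubeSumCurve 9).baseChange K) ≃+ geomPoints ((cubeSumCurve 9).baseChange K)}
    (hρ : ∀ (g : Field.absoluteGaloisGroup K) {x y : AlgebraicClosure K}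
        (h : (((cubeSumCurve 9).baseChange K).baseChange (AlgebraicClosure K)).toAffine.Nonsingular x y),
        ∃ h', ρ g (Affine.Point.some x y h) =
          Affine.Point.some (((show AlgebraicClosure K ≃ₐ[K] AlgebraicClosure K from g) v / v) ^ 2 * x)
            y h')
    (hlaw : ∀ (g : Field.absoluteGaloisGroup K) (P : geomPoints ((cubeSumCurve 9).baseChange K)),
      g • ψ P = ψ (ρ g (g • P)))
    (N : Subgroup (Field.absoluteGaloisGroup K)) [N.Normal]
    (h6 : ∀ z : AlgebraicClosure K,
      (∀ h ∈ N, (show AlgebraicClosure K ≃ₐ[K] AlgebraicClosure K from h) z = z) → z ^ 3 ≠ 6)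
    (M : ℕ) :
    KolyvaginCocycle.IsAdmissible (Field.absoluteGaloisGroup K)
      ((FixedPoints.addSubgroup N (geomPoints ((cubeSumCurve 9).baseChange K))).map ψ.toAddMonoidHom)
      ((2 ^ M : ℕ) : ℤ) := by
  refine JZero.isAdmissible_map_fixedPoints_two_pow
    (by change algebraMap ℚ K 0 = 0; exact map_zero _) (by change algebraMap ℚ K 0 = 0; exact map_zero _)
    (by change algebraMap ℚ K 0 = 0; exact map_zero _) (by change algebraMap ℚ K 0 = 0; exact map_zero _)
    hω hv hv3 hρ hlaw N (fun x hx hx0 ↦ ?_) M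
  have ha₆ : algebraMap K (AlgebraicClosure K) ((cubeSumCurve 9).baseChange K).a₆ = -(432 * 81) := by
    change algebraMap K (AlgebraicClosure K) (algebraMap ℚ K (-432 * 9 ^ 2)) = -(432 * 81)
    rw [eq_ratCast (algebraMap ℚ K), map_ratCast]
    push_cast
    ring
  rw [ha₆] at hx0
  refine h6 (x / 18) (fun h hh ↦ ?_) ?_
  · rw [map_div₀, hx h hh, map_ofNat]
  · have : x ^ 3 = 432 * 81 := by linear_combination hx0
    rw [div_pow, this]
    norm_num

/-- **Any cube root will do**: if `h` fixes one cube root `w` of `c`, it fixes every cube root `v`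
of `c` (`v/w ∈ μ₃ ⊂ K`). Use: the `v` produced by `exists_cmFrame_transport` is fixed by
`Gal(k̄/H)` as soon as `H ∋ ∛c` (Hu–Shu–Yin: `L_{(3,p)} = K(∛3, ∛p) ⊂ H_{9p}`, Prop. 2.4).
[cite: HuShuYin2019, Prop. 2.4, §1 p. 4 (μ₃ ⊂ K)] -/
theorem _root_.Literature.NumberTheory.EllipticCurves.JZero.apply_eq_self_of_cubeRoot
    {k : Type u} [Field k] {ω : k} (hω : ω ^ 2 + ω + 1 = 0)
    (h : AlgebraicClosure k ≃ₐ[k] AlgebraicClosure k) {v w : AlgebraicClosure k} (hw : w ≠ 0)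
    (hvw : v ^ 3 = w ^ 3) (hfix : h w = w) : h v = v := by
  have h1 : (v / w) ^ 3 = 1 := JZero.div_pow_three_eq_one hw hvw
  have h2 : h (v / w) = v / w := JZero.apply_eq_self_of_pow_three_eq_one hω h h1
  have e : v = v / w * w := by rw [div_mul_cancel₀ _ hw]
  rw [e, map_mul, h2, hfix]

/-- **THE RECIPE (usage theorem for rows k-p1 / k-p2 of crux `UpperOffV0HSYPlus`).** For `K ⊇ ℚ(ω)`,
`b = 9c` (`(b, c) = (p, p/9)`: `B = E_p`; `(3p², p²/3)`: `A = E_{3p²}`), a normal subgroup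
`N ≤ Γ_K` (printed `Gal(K̄/H_{9pn})`) with NO `N`-fixed cube root of `6` (*"`E_9[2](H_{9pn}) = 0`"*),
a subgroup `N' ≥ N` (printed `Gal(K̄/L)`, `L = K(∛3, ∛p)`) fixing the cube roots of `c`, representatives
`t` of `Γ_K/N'` (lifts of `Gal(L/K)`), a level `2^M`, and a point `P ∈ E_9(K̄)^N` (the derived point
`P_n`) whose class mod `2^M E_9(K̄)^N` is `N'`-invariant (Gross Prop. 3.6 from (ES1)): there are the
transport `ψ : E_9(K̄) ≃+ E_b(K̄)` and the CM family `ρ` (with their coordinate descriptions and twist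
law), the divisibility, admissibility and invariance inputs `hdiv, hA', hQ'`, and hence the CLASS
`c := kolyvaginClass (E_b)_K 2^M hdiv hA' (ψ P^χ) hQ' ∈ H¹(K, E_b[2^M])`, `P^χ = Σ_i ρ_{t_i}(t_i P)`
(memo two §57.3 `c_{χ,M}(n)`), together with Gross's Prop. 4.7 (1): `c = 0 ↔ P^χ ∈ 2^M E_9(K̄)^N`.
Everything else about `c` is the tree's `kolyvaginClass` API. [cite: GrossLMS1991, §4 (4.1)–(4.6), Prop. 4.7 (1), §12 (y_χ)]
[cite: McCallumLMS1991, §4 (4)–(6), Cor. 4.5] [cite: HuShuYin2019, §1 p. 4, §2 p. 8] -/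
theorem exists_cmFrame_kolyvaginClass (K : Type u) [Field K] [CharZero K] {ω : K}
    (hω : ω ^ 2 + ω + 1 = 0) (b c : ℚ) (hc : c ≠ 0) (hb : b = 9 * c)
    (N : Subgroup (Field.absoluteGaloisGroup K)) [N.Normal]
    (N' : Subgroup (Field.absoluteGaloisGroup K)) (hNN' : N ≤ N')
    (hN'c : ∀ h ∈ N', ∀ w : AlgebraicClosure K, w ^ 3 = algebraMap ℚ (AlgebraicClosure K) c →
      (show AlgebraicClosure K ≃ₐ[K] AlgebraicClosure K from h) w = w)
    (h6 : ∀ z : AlgebraicClosure K,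
      (∀ h ∈ N, (show AlgebraicClosure K ≃ₐ[K] AlgebraicClosure K from h) z = z) → z ^ 3 ≠ 6)
    {ι : Type w} [Fintype ι] (t : ι → Field.absoluteGaloisGroup K)
    (ht : Function.Bijective fun i ↦ (t i : Field.absoluteGaloisGroup K ⧸ N'))
    (M : ℕ) (P : geomPoints ((cubeSumCurve 9).baseChange K))
    (hPN : P ∈ FixedPoints.addSubgroup N (geomPoints ((cubeSumCurve 9).baseChange K)))
    (hP : ∀ h ∈ N', ∃ a ∈ FixedPoints.addSubgroup N (geomPoints ((cubeSumCurve 9).baseChange K)),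
      ((2 ^ M : ℕ) : ℤ) • a = h • P - P) :
    ∃ (v : AlgebraicClosure K)
      (ψ : geomPoints ((cubeSumCurve 9).baseChange K) ≃+ geomPoints ((cubeSumCurve b).baseChange K))
      (ρ : Field.absoluteGaloisGroup K →
        geomPoints ((cubeSumCurve 9).baseChange K) ≃+ geomPoints ((cubeSumCurve 9).baseChange K))
      (hdiv : ∀ Q : geomPoints ((cubeSumCurve b).baseChange K),
        ∃ R : geomPoints ((cubeSumCurve b).baseChange K), ((2 ^ M : ℕ) : ℤ) • R = Q)
      (hA' : KolyvaginCocycle.IsAdmissible (Field.absoluteGaloisGroup K)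
        ((FixedPoints.addSubgroup N (geomPoints ((cubeSumCurve 9).baseChange K))).map
          ψ.toAddMonoidHom) ((2 ^ M : ℕ) : ℤ))
      (hQ' : ψ (∑ i, ρ (t i) (t i • P)) ∈ KolyvaginCocycle.invPoints (Field.absoluteGaloisGroup K)
        ((FixedPoints.addSubgroup N (geomPoints ((cubeSumCurve 9).baseChange K))).map
          ψ.toAddMonoidHom) ((2 ^ M : ℕ) : ℤ)),
      v ^ 3 = algebraMap ℚ (AlgebraicClosure K) c ∧ v ≠ 0 ∧
      (∀ {x y : AlgebraicClosure K}
        (h : (((cubeSumCurve 9).baseChange K).baseChange (AlgebraicClosure K)).toAffine.Nonsingular x y),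
        ∃ h', ψ (Affine.Point.some x y h) = Affine.Point.some (v ^ 2 * x) (v ^ 3 * y) h') ∧
      (∀ (g : Field.absoluteGaloisGroup K) {x y : AlgebraicClosure K}
        (h : (((cubeSumCurve 9).baseChange K).baseChange (AlgebraicClosure K)).toAffine.Nonsingular x y),
        ∃ h', ρ g (Affine.Point.some x y h) =
          Affine.Point.some (((show AlgebraicClosure K ≃ₐ[K] AlgebraicClosure K from g) v / v) ^ 2 * x)
            y h') ∧
      (∀ (g : Field.absoluteGaloisGroup K) (Q : geomPoints ((cubeSumCurve 9).baseChange K)),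
        g • ψ Q = ψ (ρ g (g • Q))) ∧
      (∑ i, ρ (t i) (t i • P) ∈ FixedPoints.addSubgroup N (geomPoints ((cubeSumCurve 9).baseChange K))) ∧
      (kolyvaginClass ((cubeSumCurve b).baseChange K) ((2 ^ M : ℕ) : ℤ) hdiv hA'
          (ψ (∑ i, ρ (t i) (t i • P))) hQ' = 0 ↔
        ∃ B ∈ FixedPoints.addSubgroup N (geomPoints ((cubeSumCurve 9).baseChange K)),
          ((2 ^ M : ℕ) : ℤ) • B = ∑ i, ρ (t i) (t i • P)) := by
  obtain ⟨v, ψ, ρ, hvc, hv, hv3, hψ, hρ, hlaw, -, -, -⟩ :=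
    exists_cmFrame_transport K hω 9 b c hc hb
  have hN'v : ∀ h ∈ N', (show AlgebraicClosure K ≃ₐ[K] AlgebraicClosure K from h) v = v :=
    fun h hh ↦ hN'c h hh v hvc
  have hNv : ∀ h ∈ N, (show AlgebraicClosure K ≃ₐ[K] AlgebraicClosure K from h) v = v :=
    fun h hh ↦ hN'v h (hNN' hh)
  have hA' := isAdmissible_map_fixedPoints_cubeSumCurve_nine K hω hv hv3 hρ hlaw N h6 M
  have hQ' := JZero.cubicTwist_chiComponent_fixedPoints_mem_invPoints hω hv hv3 hρ hlaw N hN'v t ht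
    hPN hP
  have hχA : ∑ i, ρ (t i) (t i • P) ∈
      FixedPoints.addSubgroup N (geomPoints ((cubeSumCurve 9).baseChange K)) :=
    KolyvaginCocycle.chiComponent_mem (fun g ↦ (ρ g).toAddMonoidHom)
      (fun g _ ha ↦ JZero.smul_mem_fixedPoints _ N g ha)
      (fun g _ ha ↦ JZero.rho_mem_fixedPoints _ hω hv hv3 hρ N g ha) t hPN
  exact ⟨v, ψ, ρ, ((cubeSumCurve b).baseChange K).zsmul_geomPoints_surjective_of_charZero
      (by positivity), hA', hQ', hvc, hv, hψ, hρ, hlaw, hχA,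
    JZero.kolyvaginClass_cubicTwist_fixedPoints_eq_zero_iff hψ N hNv hχA hA' hQ'⟩

end HuShuYin2019

end Literature.NumberTheory.EllipticCurves
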